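import Literature.Analysis.SpecialFunctions.LogChooseStirling
import Literature.Probability.Distributions.ExponentialOrderStatistics

/-!
# BalabanUVNodes ∕ N20·N19′·N21 — THE BINOMIAL LOCAL LOWER BOUND AND THE TAIL'S MEAN-VALUE STEP (FILE H of the caricature series; Mathlib + two Literature
# files only): `C(N,k)·r^k(1−r)^{N−k} ≥ (e^{−1∕6}∕√(2π))·√(N∕(k(N−k)))·exp(−(k−Nr)²∕(N r(1−r)))` for `0 < k < N`, `0 < r < 1` (de Moivre–Laplace FROM BELOW with
# explicit constants), and `C·(q − p) ≤ P_q(S ≥ m) − P_p(S ≥ m)` whenever `C ≤ n·C(n−1,m−1)·r^{m−1}(1−r)^{n−m}` on `[p,q]` (the binomial tail's derivative, ABN (2.2.14))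

Cell `pub-ymgap` (HUMAN RULING D-0062 Track A; work-bound push D-0149, director-ym №197), width seat `pub-ymgap-dag-n20-w1` (gen 6) on node N20 = NE7b; key item K3⁷
`SpineGivenEndpointR13SepCoPH` = stmt-QuantumFields-20544 (`--kind proof --supports 20544 --as helper`); COUNT-NEUTRAL.  Bus: CLAIM-15 ∕ INTENT-19 (INBOX l.35172).
THEOREMS ONLY: no `def`, no `instance`, no `notation`, no `sorry`; imports the tree's `Literature.Analysis.SpecialFunctions.LogChooseStirling` (Robbins' two-sided Stirling
form of `log C(m,k)`, `log_choose_eq_stirling`) and `Literature.Probability.Distributions.ExponentialOrderStatistics` (the binomial tail `binomTail n r p = Σ_{m=r}^{n} C(n,m)p^m(1−p)^{n−m}`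
and its derivative `hasDerivAt_binomTail`, [ArnoldBalakrishnanNagaraja2008] (2.2.14)) BY NAME.

WHY.  This seat's g5 series (FILES A–G, p611611 … p619844) settled the EXACT criterion of K3⁷ v5 stub 2's face triple on the independent-block caricature as «the binomial
count-law ℓ¹ distances `ℓ_K := Σ_k C(n_K,k)|q_K^k(1−q_K)^{n_K−k} − p_K^k(1−p_K)^{n_K−k}|` are summable» (FILE D∕F) and bracketed it by CRIT-1's statistic (`Σ Λ_K < ∞` necessary,
`Σ √Λ_K < ∞` sufficient, FILE C), both brackets STRICT (FILE G).  Closing the squeeze — the ORDER of `ℓ` in `(n, p, q)` — needs one thing Mathlib does not have: a lower bound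
of de Moivre–Laplace type for the binomial point mass near its mean (the bulk regime's anti-concentration).  This file supplies it from the tree's Stirling–Robbins letter, plus the
mean-value step for tail events; FILE I (`…N20BlockCaricatureTVOrder`) turns the two into `ℓ ≍ min(1, n|q−p| ∕ max(1, √(n·max(p(1−p), q(1−q)))))`.
* §1 [folklore] `klTerm_le_chiSq` — `k·log(k∕(Nr)) + (N−k)·log((N−k)∕(N(1−r))) ≤ (k − Nr)²∕(N r(1−r))` (the binomial relative entropy at the point `k∕N` is below the χ²
  distance; `log x ≤ x − 1` twice and an algebraic identity) · ★★ `binomialPMF_ge_local` — for `1 ≤ k`, `k + 1 ≤ N`, `0 < r < 1`: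
  `(e^{−1∕6}∕√(2π))·√(N∕(k(N−k)))·exp(−(k−Nr)²∕(N r(1−r))) ≤ C(N,k)·r^k·(1−r)^{N−k}` (Robbins' `θ ≥ −1∕(12k) − 1∕(12(N−k)) ≥ −1∕6`).
* §2 [folklore] `binomTail_monotoneOn` (the tail `P_r(S ≥ m)` is non-decreasing in `r ∈ [0,1]`) · ★ `mul_sub_le_binomTail_sub` (a uniform floor `C` for the derivative
  `n·C(n−1,m−1)·r^{m−1}(1−r)^{n−m}` on `(p, q)` gives `C·(q−p) ≤ binomTail n m q − binomTail n m p`) · `binomTail_sub_le_of_Icc` (shrinking `[p,q]` to a sub-interval only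
  loses tail difference) · `abs_binomTail_sub_le_l1Count` (any tail event's gap is at most the count ℓ¹) · `abs_atom_sub_le_l1Count` (so is any single atom's).

v1.1 (gen 7, COMMENT ONLY — every declaration byte-identical) — referee NITs of ref-O g10 READ-279 (INBOX l.37788), answered: (i) the exponent of `binomialPMF_ge_local` is the
χ² letter `(k−Nr)²∕(N r(1−r))` WITHOUT the factor `½` of the de Moivre–Laplace local limit `exp(−(k−Nr)²∕(2N r(1−r)))` — a WEAKER exponent, hence a valid, non-sharp lower bound;
«de Moivre–Laplace from below» names the SHAPE (Gaussian-type decay around the mean with the `√(N∕(k(N−k)))` prefactor), not the sharp constant (which would need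
`KL ≤ χ²∕2 + O(|k−Nr|³∕N²)`; not attempted, not needed by FILES I∕J).  (ii) `abs_binomTail_sub_le_l1Count (p q) (n m)` keeps its explicit `(n m)` binders (FILE I applies it
positionally); its sharper HALF-ℓ¹ form is gen 7's FILE S `…N20BlockCaricatureTailOptimal.tailGap_le_half_l1Count`, where the tail gap is also shown to be ATTAINED (MLR).

HONEST FRAMING.  [folklore] real analysis ∕ finite-sum probability about the binomial law — textbook material (Feller I §VII.2–3; the constants are Robbins'); NOTHING here mentions
Bałaban's objects; nothing read at the record; proves NO estimate of the programme; refutes NO registered stub.  NE7 ∕ NE7b ∕ NE7c NOT PRINTED for `d = 4`, NOT proved; N19 ∕ N20 ∕ N21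
NOT discharged; K3⁷ OPEN, skeleton v5 941dddb108cbaacf STANDS; counts unmoved (typed 28∕28 · discharged 5∕27); no count claim.  One finite `𝕋⁴` programme at fixed `ε`, Bałaban AS
PRINTED; the YM mass gap (Clay) is NOT proved by any of this — R4 closes the conditional finite-𝕋⁴ rung `BalabanLadder.UV` only; NOT ℝ⁴, NOT OS.  No decl carries a cite tag.
-/

set_option autoImplicit false

noncomputable section

open Finset Real
open Literature.Analysis.SpecialFunctions (log_choose_eq_stirling)
open Literature.Probability.Distributions.ExponentialOrderStatistics (binomTail hasDerivAt_binomTail factorial_ratio_eq continuous_binomTail)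

namespace Summit.QuantumFields.YangMills.BalabanUVNodes.N20BinomialLocalBound

/-! ## §1 The local lower bound for the binomial point mass [folklore] -/

section Local

variable {N k : ℕ} {r : ℝ}

/-- The χ² identity behind the local bound: `k²∕(Nr) + (N−k)²∕(N(1−r)) − N = (k − Nr)²∕(N r (1−r))`. [folklore] -/
theorem chiSq_identity (hN : 0 < (N : ℝ)) (hr0 : 0 < r) (hr1 : r < 1) :
    (k : ℝ) ^ 2 / (N * r) + ((N : ℝ) - k) ^ 2 / (N * (1 - r)) - N = ((k : ℝ) - N * r) ^ 2 / (N * r * (1 - r)) := by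
  have h1 : (1 : ℝ) - r ≠ 0 := by linarith
  field_simp
  ring

/-- **RELATIVE ENTROPY ≤ χ²** at one point [folklore]: for `0 < k < N`, `0 < r < 1`,
`k·log(k∕(Nr)) + (N−k)·log((N−k)∕(N(1−r))) ≤ (k − Nr)²∕(N r (1−r))` (`log x ≤ x − 1` on both terms). -/
theorem klTerm_le_chiSq (hk : 1 ≤ k) (hkN : k + 1 ≤ N) (hr0 : 0 < r) (hr1 : r < 1) :
    (k : ℝ) * Real.log (k / (N * r)) + ((N : ℝ) - k) * Real.log (((N : ℝ) - k) / (N * (1 - r))) ≤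
      ((k : ℝ) - N * r) ^ 2 / (N * r * (1 - r)) := by
  have hkR : (0 : ℝ) < k := by exact_mod_cast hk
  have hNR : (0 : ℝ) < N := by exact_mod_cast (show 0 < N by omega)
  have hNk : (0 : ℝ) < (N : ℝ) - k := by
    have : (k : ℝ) + 1 ≤ N := by exact_mod_cast hkN
    linarith
  have h1r : (0 : ℝ) < 1 - r := by linarith
  have hA : Real.log (k / (N * r)) ≤ k / (N * r) - 1 := Real.log_le_sub_one_of_pos (by positivity)
  have hB : Real.log (((N : ℝ) - k) / (N * (1 - r))) ≤ ((N : ℝ) - k) / (N * (1 - r)) - 1 :=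
    Real.log_le_sub_one_of_pos (by positivity)
  have hA' := mul_le_mul_of_nonneg_left hA hkR.le
  have hB' := mul_le_mul_of_nonneg_left hB hNk.le
  have key : (k : ℝ) * (k / (N * r) - 1) + ((N : ℝ) - k) * (((N : ℝ) - k) / (N * (1 - r)) - 1) =
      ((k : ℝ) - N * r) ^ 2 / (N * r * (1 - r)) := by
    rw [← chiSq_identity hNR hr0 hr1]
    field_simp
    ring
  linarith

/-- The exponent bookkeeping: `[N log N − k log k − (N−k) log(N−k)] + k log r + (N−k) log(1−r) = −[k·log(k∕(Nr)) + (N−k)·log((N−k)∕(N(1−r)))]`. [folklore] -/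
theorem entropy_add_logWeights_eq (hk : 1 ≤ k) (hkN : k + 1 ≤ N) (hr0 : 0 < r) (hr1 : r < 1) :
    ((N : ℝ) * Real.log N - k * Real.log k - ((N : ℝ) - k) * Real.log ((N : ℝ) - k)) + k * Real.log r + ((N : ℝ) - k) * Real.log (1 - r) =
      -((k : ℝ) * Real.log (k / (N * r)) + ((N : ℝ) - k) * Real.log (((N : ℝ) - k) / (N * (1 - r)))) := by
  have hkR : (0 : ℝ) < k := by exact_mod_cast hk
  have hNR : (0 : ℝ) < N := by exact_mod_cast (show 0 < N by omega)
  have hNk : (0 : ℝ) < (N : ℝ) - k := by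
    have : (k : ℝ) + 1 ≤ N := by exact_mod_cast hkN
    linarith
  have h1r : (0 : ℝ) < 1 - r := by linarith
  rw [Real.log_div hkR.ne' (by positivity), Real.log_div hNk.ne' (by positivity), Real.log_mul hNR.ne' hr0.ne',
    Real.log_mul hNR.ne' h1r.ne']
  ring

/-- ★★ **THE BINOMIAL LOCAL LOWER BOUND** (de Moivre–Laplace from below, explicit constants) [folklore]: for `1 ≤ k`, `k + 1 ≤ N`, `0 < r < 1`,
`(e^{−1∕6}∕√(2π))·√(N∕(k(N−k)))·exp(−(k − Nr)²∕(N r(1−r))) ≤ C(N,k)·r^k·(1−r)^{N−k}`.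
Chain: Robbins' Stirling form of `log C(N,k)` (`log_choose_eq_stirling`, `θ ≥ −1∕(12k) − 1∕(12(N−k)) ≥ −1∕6`), `entropy_add_logWeights_eq`, `klTerm_le_chiSq`. -/
theorem binomialPMF_ge_local (hk : 1 ≤ k) (hkN : k + 1 ≤ N) (hr0 : 0 < r) (hr1 : r < 1) :
    Real.exp (-(1 / 6)) / Real.sqrt (2 * Real.pi) * Real.sqrt (N / (k * ((N : ℝ) - k))) * Real.exp (-(((k : ℝ) - N * r) ^ 2 / (N * r * (1 - r)))) ≤
      (N.choose k : ℝ) * r ^ k * (1 - r) ^ (N - k) := by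
  have hkR : (0 : ℝ) < k := by exact_mod_cast hk
  have hN0 : 0 < N := by omega
  have hNR : (0 : ℝ) < N := by exact_mod_cast hN0
  have hkltN : k < N := by omega
  have hNk : (0 : ℝ) < (N : ℝ) - k := by
    have : (k : ℝ) + 1 ≤ N := by exact_mod_cast hkN
    linarith
  have h1r : (0 : ℝ) < 1 - r := by linarith
  have hchoose : (0 : ℝ) < N.choose k := by exact_mod_cast Nat.choose_pos hkltN.le
  have hpmf : 0 < (N.choose k : ℝ) * r ^ k * (1 - r) ^ (N - k) := by positivity
  obtain ⟨θ, hθl, -, hθ⟩ := log_choose_eq_stirling hk hkltN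
  -- `θ ≥ −1∕6`
  have hθ6 : -(1 / 6 : ℝ) ≤ θ := by
    have hk1 : (1 : ℝ) ≤ k := by exact_mod_cast hk
    have hNk1 : (1 : ℝ) ≤ (N : ℝ) - k := by
      have : (k : ℝ) + 1 ≤ N := by exact_mod_cast hkN
      linarith
    have h1 : 1 / (12 * (k : ℝ)) ≤ 1 / 12 := one_div_le_one_div_of_le (by norm_num) (by linarith)
    have h2 : 1 / (12 * ((N : ℝ) - k)) ≤ 1 / 12 := one_div_le_one_div_of_le (by norm_num) (by linarith)
    linarith
  -- compare logarithms
  rw [← Real.exp_log hpmf]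
  have hlogpmf : Real.log ((N.choose k : ℝ) * r ^ k * (1 - r) ^ (N - k)) =
      Real.log (N.choose k) + k * Real.log r + ((N : ℝ) - k) * Real.log (1 - r) := by
    rw [Real.log_mul (by positivity) (by positivity), Real.log_mul hchoose.ne' (by positivity), Real.log_pow, Real.log_pow,
      Nat.cast_sub hkltN.le]
  have hsq : Real.sqrt (N / (k * ((N : ℝ) - k))) = Real.exp ((Real.log N - Real.log k - Real.log ((N : ℝ) - k)) / 2) := by
    rw [Real.sqrt_eq_rpow, Real.rpow_def_of_pos (by positivity), Real.log_div hNR.ne' (by positivity), Real.log_mul hkR.ne' hNk.ne']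
    congr 1; ring
  have hsq2 : Real.sqrt (2 * Real.pi) = Real.exp (Real.log (2 * Real.pi) / 2) := by
    rw [Real.sqrt_eq_rpow, Real.rpow_def_of_pos (by positivity)]
    congr 1; ring
  rw [hsq, hsq2, div_eq_mul_inv, ← Real.exp_neg, ← Real.exp_add, ← Real.exp_add, ← Real.exp_add, Real.exp_le_exp, hlogpmf, hθ]
  have hKL := klTerm_le_chiSq hk hkN hr0 hr1
  have hE := entropy_add_logWeights_eq hk hkN hr0 hr1
  linarith

end Local

/-! ## §2 Tail events: monotonicity in the rate and the mean-value lower bound [folklore] -/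

section Tail

variable {n m : ℕ}

/-- The derivative of the binomial tail `P_r(S ≥ m)` (`1 ≤ m ≤ n`) in the `n·C(n−1,m−1)` form: `n·C(n−1,m−1)·r^{m−1}(1−r)^{n−m}` (the tree's ABN (2.2.14) `hasDerivAt_binomTail`
with `factorial_ratio_eq`). [folklore] -/
theorem hasDerivAt_binomTail' (hm : 1 ≤ m) (hmn : m ≤ n) (r : ℝ) :
    HasDerivAt (binomTail n m) ((n : ℝ) * ((n - 1).choose (m - 1) : ℝ) * r ^ (m - 1) * (1 - r) ^ (n - m)) r := by
  have h := hasDerivAt_binomTail n m hm hmn r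
  rwa [factorial_ratio_eq n m hm hmn] at h

/-- The tail's derivative is non-negative on `[0,1]`. [folklore] -/
theorem binomTail_deriv_nonneg (n m : ℕ) {r : ℝ} (hr0 : 0 ≤ r) (hr1 : r ≤ 1) :
    0 ≤ (n : ℝ) * ((n - 1).choose (m - 1) : ℝ) * r ^ (m - 1) * (1 - r) ^ (n - m) := by
  have : 0 ≤ 1 - r := by linarith
  positivity

/-- ★ **THE BINOMIAL TAIL IS NON-DECREASING IN THE RATE** on `[0,1]` (`1 ≤ m ≤ n`). [folklore] -/
theorem binomTail_monotoneOn (hm : 1 ≤ m) (hmn : m ≤ n) : MonotoneOn (binomTail n m) (Set.Icc (0 : ℝ) 1) := by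
  refine monotoneOn_of_deriv_nonneg (convex_Icc 0 1) (continuous_binomTail n m).continuousOn
    (fun x _ => (hasDerivAt_binomTail' hm hmn x).differentiableAt.differentiableWithinAt) fun x hx => ?_
  rw [interior_Icc] at hx
  rw [(hasDerivAt_binomTail' hm hmn x).deriv]
  exact binomTail_deriv_nonneg n m hx.1.le hx.2.le

/-- ★ **MEAN-VALUE LOWER BOUND FOR A TAIL EVENT** [folklore]: if `C ≤ n·C(n−1,m−1)·r^{m−1}(1−r)^{n−m}` for every `r ∈ (p, q)` (`p ≤ q`, `1 ≤ m ≤ n`), then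
`C·(q − p) ≤ binomTail n m q − binomTail n m p` (`Convex.mul_sub_le_image_sub_of_le_deriv`). -/
theorem mul_sub_le_binomTail_sub (hm : 1 ≤ m) (hmn : m ≤ n) {p q C : ℝ} (hpq : p ≤ q)
    (hC : ∀ r, p < r → r < q → C ≤ (n : ℝ) * ((n - 1).choose (m - 1) : ℝ) * r ^ (m - 1) * (1 - r) ^ (n - m)) :
    C * (q - p) ≤ binomTail n m q - binomTail n m p := by
  rcases eq_or_lt_of_le hpq with rfl | hlt
  · simp
  refine Convex.mul_sub_le_image_sub_of_le_deriv (convex_Icc p q) (continuous_binomTail n m).continuousOn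
    (fun x _ => (hasDerivAt_binomTail' hm hmn x).differentiableAt.differentiableWithinAt) (fun x hx => ?_) p
    (Set.left_mem_Icc.2 hpq) q (Set.right_mem_Icc.2 hpq) hpq
  rw [interior_Icc] at hx
  rw [(hasDerivAt_binomTail' hm hmn x).deriv]
  exact hC x hx.1 hx.2

/-- Shrinking the rate interval inside `[0,1]` only loses tail difference: `p ≤ p' ≤ q' ≤ q` ⇒ `binomTail q' − binomTail p' ≤ binomTail q − binomTail p`. [folklore] -/
theorem binomTail_sub_le_of_Icc (hm : 1 ≤ m) (hmn : m ≤ n) {p p' q' q : ℝ} (hp0 : 0 ≤ p) (hpp' : p ≤ p') (hp'q' : p' ≤ q') (hq'q : q' ≤ q) (hq1 : q ≤ 1) :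
    binomTail n m q' - binomTail n m p' ≤ binomTail n m q - binomTail n m p := by
  have hmono := binomTail_monotoneOn (n := n) hm hmn
  have h1 : binomTail n m p ≤ binomTail n m p' :=
    hmono ⟨hp0, by linarith⟩ ⟨by linarith, by linarith⟩ hpp'
  have h2 : binomTail n m q' ≤ binomTail n m q :=
    hmono ⟨by linarith, by linarith⟩ ⟨by linarith, hq1⟩ hq'q
  linarith

/-- **ANY TAIL EVENT'S GAP IS AT MOST THE COUNT ℓ¹**: `|binomTail n m q − binomTail n m p| ≤ Σ_{k ≤ n} C(n,k)·|q^k(1−q)^{n−k} − p^k(1−p)^{n−k}|` (triangle inequality on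
the sub-sum `k ∈ [m, n]`). [folklore] -/
theorem abs_binomTail_sub_le_l1Count (p q : ℝ) (n m : ℕ) :
    |binomTail n m q - binomTail n m p| ≤ ∑ k ∈ Finset.range (n + 1), (n.choose k : ℝ) * |q ^ k * (1 - q) ^ (n - k) - p ^ k * (1 - p) ^ (n - k)| := by
  unfold binomTail
  rw [← Finset.sum_sub_distrib]
  have hsub : Finset.Icc m n ⊆ Finset.range (n + 1) := fun k hk => Finset.mem_range.2 (by have := (Finset.mem_Icc.1 hk).2; omega)
  calc |∑ k ∈ Finset.Icc m n, ((n.choose k : ℝ) * q ^ k * (1 - q) ^ (n - k) - (n.choose k : ℝ) * p ^ k * (1 - p) ^ (n - k))|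
      ≤ ∑ k ∈ Finset.Icc m n, |(n.choose k : ℝ) * q ^ k * (1 - q) ^ (n - k) - (n.choose k : ℝ) * p ^ k * (1 - p) ^ (n - k)| := Finset.abs_sum_le_sum_abs _ _
    _ = ∑ k ∈ Finset.Icc m n, (n.choose k : ℝ) * |q ^ k * (1 - q) ^ (n - k) - p ^ k * (1 - p) ^ (n - k)| :=
        Finset.sum_congr rfl fun k _ => by
          rw [show (n.choose k : ℝ) * q ^ k * (1 - q) ^ (n - k) - (n.choose k : ℝ) * p ^ k * (1 - p) ^ (n - k) =
            (n.choose k : ℝ) * (q ^ k * (1 - q) ^ (n - k) - p ^ k * (1 - p) ^ (n - k)) by ring, abs_mul, abs_of_nonneg (Nat.cast_nonneg _)]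
    _ ≤ _ := Finset.sum_le_sum_of_subset_of_nonneg hsub fun k _ _ => by positivity

/-- **ANY SINGLE ATOM'S GAP IS AT MOST THE COUNT ℓ¹**: for `k ≤ n`, `C(n,k)·|q^k(1−q)^{n−k} − p^k(1−p)^{n−k}| ≤ ℓ`. [folklore] -/
theorem abs_atom_sub_le_l1Count (p q : ℝ) {n k : ℕ} (hk : k ≤ n) :
    (n.choose k : ℝ) * |q ^ k * (1 - q) ^ (n - k) - p ^ k * (1 - p) ^ (n - k)| ≤
      ∑ j ∈ Finset.range (n + 1), (n.choose j : ℝ) * |q ^ j * (1 - q) ^ (n - j) - p ^ j * (1 - p) ^ (n - j)| :=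
  Finset.single_le_sum (f := fun j => (n.choose j : ℝ) * |q ^ j * (1 - q) ^ (n - j) - p ^ j * (1 - p) ^ (n - j)|) (fun j _ => by positivity)
    (Finset.mem_range.2 (by omega))

end Tail

end Summit.QuantumFields.YangMills.BalabanUVNodes.N20BinomialLocalBound

end
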